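import Literature.Analysis.Complex.VitaliConvergence
import Literature.Analysis.Complex.WeakHolomorphy

/-!
# Vitali's theorem for Hilbert-space-valued holomorphic families on a strip — stub `stub_hilbertVitali`

Line `Sketch` of crux `MirrorModularBoosts.SoftKernelBoostCovariance` (stmt-QuantumFields-14999), stub (T6) of the
registered skeleton `Cruxes/SoftKernelBoostCovariance/Lines/Sketch.lean`.  Pure functional analysis over Mathlib and
the tree's complex-analysis support files (`Literature/Analysis/Complex/VitaliConvergence.lean`,
`Literature/Analysis/Complex/WeakHolomorphy.lean`).

**Statement** (`stub_hilbertVitali`).  Let `H` be a complex Hilbert space, `ε > 0`, and let `V_k : ℂ → H` be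
holomorphic on the growing rectangles `Q_k = {|Re θ| < ε, |Im θ| < k}` with the uniform exponential-type bound
`‖V_k θ‖ ≤ M e^{N |Im θ|}` on `Q_k`, converging in norm at every real point `|θ| < ε` to `g θ`.  Then there is
`W : ℂ → H`, holomorphic on the strip `U = {|Re θ| < ε}`, with `‖W θ‖ ≤ M e^{N |Im θ|}` on `U` and `W θ = g θ` for
real `|θ| < ε`.

**Proof.**
1. *Scalar Vitali on a fixed rectangle* (`tendsto_inner_rect`).  Fix `w ∈ H` and `m ≥ 1`.  The tail sequence
   `k ↦ ⟪w, V_{k+m} ·⟫` is holomorphic on the open convex rectangle `Q_m ⊆ Q_{k+m}`, bounded there by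
   `‖w‖ M e^{|N| m}` (Cauchy–Schwarz; `M ≥ 0` is forced by the bound at `θ = 0`, `nonneg_of_bound`), and converges
   at the real points `0 < s < ε`, which accumulate at `0 ∈ Q_m`.  By Vitali's convergence theorem
   (`Literature.Analysis.Complex.exists_tendstoLocallyUniformlyOn_of_frequently_tendsto`) it converges locally
   uniformly on `Q_m` to a holomorphic function; in particular `⟪w, V_k ζ⟫` converges for every `ζ ∈ Q_m`
   (`Filter.tendsto_add_atTop_iff_nat` passes from the tail to the full sequence).
2. *The weak limit on the strip.*  Every `ζ ∈ U` lies in `Q_m` for `m = ⌊|Im ζ|⌋ + 1`, so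
   `f_w ζ := lim_k ⟪w, V_k ζ⟫` exists on `U` (`exists_tendsto_inner`), is holomorphic in `ζ` on `U`
   (`differentiableOn_lim`: differentiability is local and `Q_m` is open), is conjugate-linear in `w`
   (`lim_add`, `lim_smul`), satisfies `‖f_w ζ‖ ≤ ‖w‖ M e^{N |Im ζ|}` (`norm_lim_le`, limit of the bound), and
   `f_w θ = ⟪w, g θ⟫` at real points (`lim_ofReal`).
3. *Riesz* (`exists_inner_eq`).  For `ζ ∈ U` the bounded linear functional `w ↦ conj (f_w ζ)` is represented
   (`InnerProductSpace.toDual`) by a vector `W ζ` with `⟪w, W ζ⟫ = f_w ζ` and `‖W ζ‖ ≤ M e^{N |Im ζ|}`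
   (`exists_weakLimit`).
4. *Weak ⇒ strong holomorphy* (Dunford): `W` is locally bounded on `U` and all its matrix elements
   `ζ ↦ ⟪w, W ζ⟫ = f_w ζ` are holomorphic, hence `W` is holomorphic
   (`Literature.Analysis.Complex.differentiableOn_of_forall_inner`).  At real points
   `⟪w, W θ⟫ = ⟪w, g θ⟫` for all `w`, so `W θ = g θ`.

References: G. Vitali (1903) / M. B. Porter (1904), see E. C. Titchmarsh, *The Theory of Functions*, §5.21;
N. Dunford, weak = strong holomorphy, see W. Rudin, *Functional Analysis*, Thm. 3.31; W. Arendt, N. Nikolski,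
Vector-valued holomorphic functions revisited, Math. Z. 234 (2000), Thm. 2.1 (the vector-valued Vitali theorem).
Folklore.
-/

noncomputable section

namespace Summit.QuantumFields.YangMills.Theorems.SoftKernelBoostCovariance.Sketch

open Filter Topology Metric Set
open scoped InnerProductSpace ComplexConjugate

namespace HilbertVitali

/-! ### The rectangles `Q_m = {|Re θ| < ε ∧ |Im θ| < m}` -/

/-- The rectangle `{|Re θ| < ε ∧ |Im θ| < m}` is open. -/
theorem isOpen_rect (ε m : ℝ) : IsOpen {θ : ℂ | |θ.re| < ε ∧ |θ.im| < m} :=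
  (isOpen_lt (continuous_abs.comp Complex.continuous_re) continuous_const).and
    (isOpen_lt (continuous_abs.comp Complex.continuous_im) continuous_const)

/-- The rectangle `{|Re θ| < ε ∧ |Im θ| < m}` is convex (an intersection of four real half-planes);
cf. `RayPositivity.convex_reStrip` for the strip. -/
theorem convex_rect (ε m : ℝ) : Convex ℝ {θ : ℂ | |θ.re| < ε ∧ |θ.im| < m} := by
  have hre : IsLinearMap ℝ fun w : ℂ => w.re :=
    ⟨fun u v => Complex.add_re u v, fun c u => Complex.smul_re c u⟩
  have him : IsLinearMap ℝ fun w : ℂ => w.im :=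
    ⟨fun u v => Complex.add_im u v, fun c u => Complex.smul_im c u⟩
  have hset : {θ : ℂ | |θ.re| < ε ∧ |θ.im| < m} =
      ({θ : ℂ | -ε < θ.re} ∩ {θ : ℂ | θ.re < ε}) ∩ ({θ : ℂ | -m < θ.im} ∩ {θ : ℂ | θ.im < m}) := by
    ext θ
    simp only [mem_setOf_eq, mem_inter_iff, abs_lt]
  rw [hset]
  exact ((convex_halfSpace_gt hre _).inter (convex_halfSpace_lt hre _)).inter
    ((convex_halfSpace_gt him _).inter (convex_halfSpace_lt him _))

/-- Every point of the strip `{|Re θ| < ε}` lies in the rectangle of height `⌊|Im θ|⌋ + 1`. -/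
theorem mem_rect_floor {ε : ℝ} {ζ : ℂ} (hζ : |ζ.re| < ε) :
    ζ ∈ {θ : ℂ | |θ.re| < ε ∧ |θ.im| < ((⌊|ζ.im|⌋₊ + 1 : ℕ) : ℝ)} := by
  refine ⟨hζ, ?_⟩
  push_cast
  exact Nat.lt_floor_add_one _

variable {H : Type*} [NormedAddCommGroup H] [InnerProductSpace ℂ H]
  {ε M N : ℝ} {V : ℕ → ℂ → H} {g : ℝ → H}

/-! ### Step 1: scalar Vitali on a fixed rectangle -/

omit [InnerProductSpace ℂ H] in
/-- The exponential-type bound at `θ = 0 ∈ Q_1` forces `0 ≤ M`. -/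
theorem nonneg_of_bound (hε : 0 < ε)
    (hVb : ∀ (k : ℕ) (θ : ℂ), |θ.re| < ε → |θ.im| < (k : ℝ) → ‖V k θ‖ ≤ M * Real.exp (N * |θ.im|)) :
    0 ≤ M := by
  have h := hVb 1 0 (by simpa using hε) (by simp)
  simp only [Complex.zero_im, abs_zero, mul_zero, Real.exp_zero, mul_one] at h
  exact (norm_nonneg _).trans h

/-- Monotonicity of the bound in the height: `M e^{N |y|} ≤ M e^{|N| R}` for `|y| ≤ R` and `M ≥ 0`. -/
theorem bound_mono (hM : 0 ≤ M) {y R : ℝ} (hy : |y| ≤ R) :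
    M * Real.exp (N * |y|) ≤ M * Real.exp (|N| * R) := by
  refine mul_le_mul_of_nonneg_left (Real.exp_le_exp.2 ?_) hM
  exact (mul_le_mul_of_nonneg_right (le_abs_self N) (abs_nonneg y)).trans
    (mul_le_mul_of_nonneg_left hy (abs_nonneg N))

/-- **Scalar Vitali on the rectangle `Q_m`.**  For `w ∈ H` and `m ≥ 1`, the matrix elements `⟪w, V_k ζ⟫`
converge for every `ζ ∈ Q_m`, to a function holomorphic on `Q_m`: Vitali's convergence theorem applied to the
tail sequence `k ↦ ⟪w, V_{k+m} ·⟫`, holomorphic and uniformly bounded on `Q_m` and convergent at the real points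
`0 < s < ε` accumulating at `0`. -/
theorem tendsto_inner_rect (hε : 0 < ε)
    (hVd : ∀ k : ℕ, DifferentiableOn ℂ (V k) {θ : ℂ | |θ.re| < ε ∧ |θ.im| < (k : ℝ)})
    (hVb : ∀ (k : ℕ) (θ : ℂ), |θ.re| < ε → |θ.im| < (k : ℝ) → ‖V k θ‖ ≤ M * Real.exp (N * |θ.im|))
    (hconv : ∀ θ : ℝ, |θ| < ε → Tendsto (fun k => V k θ) atTop (𝓝 (g θ)))
    (w : H) {m : ℕ} (hm : 0 < m) :
    ∃ f : ℂ → ℂ, DifferentiableOn ℂ f {θ : ℂ | |θ.re| < ε ∧ |θ.im| < (m : ℝ)} ∧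
      ∀ ζ ∈ {θ : ℂ | |θ.re| < ε ∧ |θ.im| < (m : ℝ)},
        Tendsto (fun k => ⟪w, V k ζ⟫_ℂ) atTop (𝓝 (f ζ)) := by
  set Q : Set ℂ := {θ : ℂ | |θ.re| < ε ∧ |θ.im| < (m : ℝ)} with hQ
  have hQo : IsOpen Q := isOpen_rect ε m
  have hQc : IsPreconnected Q := (convex_rect ε m).isPreconnected
  have hM : 0 ≤ M := nonneg_of_bound hε hVb
  -- the tail sequence, holomorphic on `Q ⊆ Q_{k+m}`
  set F : ℕ → ℂ → ℂ := fun k θ => ⟪w, V (k + m) θ⟫_ℂ with hF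
  have hsub : ∀ k : ℕ, Q ⊆ {θ : ℂ | |θ.re| < ε ∧ |θ.im| < ((k + m : ℕ) : ℝ)} := fun k θ hθ =>
    ⟨hθ.1, hθ.2.trans_le (by exact_mod_cast Nat.le_add_left m k)⟩
  have hFd : ∀ k, DifferentiableOn ℂ (F k) Q := fun k => by
    have h := (innerSL ℂ w).differentiable.comp_differentiableOn ((hVd (k + m)).mono (hsub k))
    simpa only [Function.comp_def, innerSL_apply_apply] using h
  -- uniformly bounded on `Q`
  have hFb : ∀ a ∈ Q, ∃ B : ℝ, ∃ r > 0, ∀ n, ∀ z ∈ ball a r ∩ Q, ‖F n z‖ ≤ B := fun a _ =>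
    ⟨‖w‖ * (M * Real.exp (|N| * m)), 1, one_pos, fun n z hz =>
      calc ‖F n z‖ = ‖⟪w, V (n + m) z⟫_ℂ‖ := rfl
        _ ≤ ‖w‖ * ‖V (n + m) z‖ := norm_inner_le_norm _ _
        _ ≤ ‖w‖ * (M * Real.exp (N * |z.im|)) :=
            mul_le_mul_of_nonneg_left (hVb (n + m) z hz.2.1 (hsub n hz.2).2) (norm_nonneg _)
        _ ≤ ‖w‖ * (M * Real.exp (|N| * m)) :=
            mul_le_mul_of_nonneg_left (bound_mono hM hz.2.2.le) (norm_nonneg _)⟩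
  -- `0 ∈ Q`, and the sequence converges at the real points `0 < s < ε`, which accumulate at `0`
  have h0 : (0 : ℂ) ∈ Q := ⟨by simpa using hε, by simpa using hm⟩
  have hS : ∃ᶠ z in 𝓝[≠] (0 : ℂ), ∃ c : ℂ, Tendsto (fun n => F n z) atTop (𝓝 c) := by
    have htend : Tendsto (fun s : ℝ => (s : ℂ)) (𝓝[>] 0) (𝓝[≠] 0) := by
      have h1 : Tendsto (fun s : ℝ => (s : ℂ)) (𝓝[>] 0) (𝓝[{0}ᶜ] ((0 : ℝ) : ℂ)) :=
        Complex.continuous_ofReal.continuousWithinAt.tendsto_nhdsWithin fun s hs =>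
          Complex.ofReal_ne_zero.2 (ne_of_gt hs)
      simpa using h1
    have hev : ∀ᶠ s : ℝ in 𝓝[>] 0, ∃ c : ℂ, Tendsto (fun n => F n (s : ℂ)) atTop (𝓝 c) := by
      have : ∀ᶠ s : ℝ in 𝓝[>] (0 : ℝ), s < ε :=
        (eventually_lt_nhds hε).filter_mono nhdsWithin_le_nhds
      filter_upwards [this, self_mem_nhdsWithin] with s hs hs0
      have habs : |s| < ε := abs_lt.2 ⟨by linarith [Set.mem_Ioi.1 hs0], hs⟩
      have h1 : Tendsto (fun n => V (n + m) (s : ℂ)) atTop (𝓝 (g s)) :=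
        (hconv s habs).comp (tendsto_add_atTop_nat m)
      exact ⟨⟪w, g s⟫_ℂ, tendsto_const_nhds.inner h1⟩
    exact htend.frequently hev.frequently
  obtain ⟨f, hf, hlim⟩ :=
    Literature.Analysis.Complex.exists_tendstoLocallyUniformlyOn_of_frequently_tendsto
      hQo hQc hFd hFb h0 hS
  refine ⟨f, hf, fun ζ hζ => ?_⟩
  have h1 : Tendsto (fun k => F k ζ) atTop (𝓝 (f ζ)) := hlim.tendsto_at hζ
  exact (tendsto_add_atTop_iff_nat (f := fun k => ⟪w, V k ζ⟫_ℂ) m).1 h1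

/-! ### Step 2: the weak limit `f_w ζ = lim_k ⟪w, V_k ζ⟫` on the strip -/

/-- The matrix elements `⟪w, V_k ζ⟫` converge at every point of the strip. -/
theorem exists_tendsto_inner (hε : 0 < ε)
    (hVd : ∀ k : ℕ, DifferentiableOn ℂ (V k) {θ : ℂ | |θ.re| < ε ∧ |θ.im| < (k : ℝ)})
    (hVb : ∀ (k : ℕ) (θ : ℂ), |θ.re| < ε → |θ.im| < (k : ℝ) → ‖V k θ‖ ≤ M * Real.exp (N * |θ.im|))
    (hconv : ∀ θ : ℝ, |θ| < ε → Tendsto (fun k => V k θ) atTop (𝓝 (g θ)))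
    (w : H) {ζ : ℂ} (hζ : |ζ.re| < ε) :
    Tendsto (fun k => ⟪w, V k ζ⟫_ℂ) atTop (𝓝 (limUnder atTop fun k => ⟪w, V k ζ⟫_ℂ)) := by
  obtain ⟨f, -, hf⟩ := tendsto_inner_rect hε hVd hVb hconv w (Nat.succ_pos ⌊|ζ.im|⌋₊)
  exact tendsto_nhds_limUnder ⟨_, hf ζ (mem_rect_floor hζ)⟩

/-- The weak limit `ζ ↦ lim_k ⟪w, V_k ζ⟫` is holomorphic on the strip (it is the Vitali limit on each
rectangle, and differentiability is local). -/
theorem differentiableOn_lim (hε : 0 < ε)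
    (hVd : ∀ k : ℕ, DifferentiableOn ℂ (V k) {θ : ℂ | |θ.re| < ε ∧ |θ.im| < (k : ℝ)})
    (hVb : ∀ (k : ℕ) (θ : ℂ), |θ.re| < ε → |θ.im| < (k : ℝ) → ‖V k θ‖ ≤ M * Real.exp (N * |θ.im|))
    (hconv : ∀ θ : ℝ, |θ| < ε → Tendsto (fun k => V k θ) atTop (𝓝 (g θ))) (w : H) :
    DifferentiableOn ℂ (fun ζ => limUnder atTop fun k => ⟪w, V k ζ⟫_ℂ) {θ : ℂ | |θ.re| < ε} := by
  intro ζ hζ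
  obtain ⟨f, hfd, hf⟩ := tendsto_inner_rect hε hVd hVb hconv w (Nat.succ_pos ⌊|ζ.im|⌋₊)
  have hQo := isOpen_rect ε ((⌊|ζ.im|⌋₊ + 1 : ℕ) : ℝ)
  have heq : DifferentiableOn ℂ (fun ζ => limUnder atTop fun k => ⟪w, V k ζ⟫_ℂ)
      {θ : ℂ | |θ.re| < ε ∧ |θ.im| < ((⌊|ζ.im|⌋₊ + 1 : ℕ) : ℝ)} :=
    hfd.congr fun z hz => (hf z hz).limUnder_eq
  exact (heq.differentiableAt (hQo.mem_nhds (mem_rect_floor hζ))).differentiableWithinAt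

/-- The weak limit inherits the exponential-type bound: `‖lim_k ⟪w, V_k ζ⟫‖ ≤ ‖w‖ M e^{N |Im ζ|}`. -/
theorem norm_lim_le (hε : 0 < ε)
    (hVd : ∀ k : ℕ, DifferentiableOn ℂ (V k) {θ : ℂ | |θ.re| < ε ∧ |θ.im| < (k : ℝ)})
    (hVb : ∀ (k : ℕ) (θ : ℂ), |θ.re| < ε → |θ.im| < (k : ℝ) → ‖V k θ‖ ≤ M * Real.exp (N * |θ.im|))
    (hconv : ∀ θ : ℝ, |θ| < ε → Tendsto (fun k => V k θ) atTop (𝓝 (g θ)))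
    (w : H) {ζ : ℂ} (hζ : |ζ.re| < ε) :
    ‖limUnder atTop fun k => ⟪w, V k ζ⟫_ℂ‖ ≤ ‖w‖ * (M * Real.exp (N * |ζ.im|)) := by
  refine le_of_tendsto (exists_tendsto_inner hε hVd hVb hconv w hζ).norm ?_
  refine eventually_atTop.2 ⟨⌊|ζ.im|⌋₊ + 1, fun k hk => ?_⟩
  have hk' : |ζ.im| < (k : ℝ) :=
    (Nat.lt_floor_add_one _).trans_le (by exact_mod_cast hk)
  exact (norm_inner_le_norm _ _).trans
    (mul_le_mul_of_nonneg_left (hVb k ζ hζ hk') (norm_nonneg _))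

/-- The weak limit is additive in the test vector. -/
theorem lim_add (hε : 0 < ε)
    (hVd : ∀ k : ℕ, DifferentiableOn ℂ (V k) {θ : ℂ | |θ.re| < ε ∧ |θ.im| < (k : ℝ)})
    (hVb : ∀ (k : ℕ) (θ : ℂ), |θ.re| < ε → |θ.im| < (k : ℝ) → ‖V k θ‖ ≤ M * Real.exp (N * |θ.im|))
    (hconv : ∀ θ : ℝ, |θ| < ε → Tendsto (fun k => V k θ) atTop (𝓝 (g θ)))
    (v w : H) {ζ : ℂ} (hζ : |ζ.re| < ε) :
    (limUnder atTop fun k => ⟪v + w, V k ζ⟫_ℂ) =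
      (limUnder atTop fun k => ⟪v, V k ζ⟫_ℂ) + limUnder atTop fun k => ⟪w, V k ζ⟫_ℂ := by
  refine Tendsto.limUnder_eq ?_
  simp only [inner_add_left]
  exact (exists_tendsto_inner hε hVd hVb hconv v hζ).add (exists_tendsto_inner hε hVd hVb hconv w hζ)

/-- The weak limit is conjugate-homogeneous in the test vector. -/
theorem lim_smul (hε : 0 < ε)
    (hVd : ∀ k : ℕ, DifferentiableOn ℂ (V k) {θ : ℂ | |θ.re| < ε ∧ |θ.im| < (k : ℝ)})
    (hVb : ∀ (k : ℕ) (θ : ℂ), |θ.re| < ε → |θ.im| < (k : ℝ) → ‖V k θ‖ ≤ M * Real.exp (N * |θ.im|))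
    (hconv : ∀ θ : ℝ, |θ| < ε → Tendsto (fun k => V k θ) atTop (𝓝 (g θ)))
    (a : ℂ) (w : H) {ζ : ℂ} (hζ : |ζ.re| < ε) :
    (limUnder atTop fun k => ⟪a • w, V k ζ⟫_ℂ) = conj a * limUnder atTop fun k => ⟪w, V k ζ⟫_ℂ := by
  refine Tendsto.limUnder_eq ?_
  simp only [inner_smul_left]
  exact (exists_tendsto_inner hε hVd hVb hconv w hζ).const_mul _

/-- At the real points the weak limit is the matrix element of the norm limit `g`. -/
theorem lim_ofReal (hconv : ∀ θ : ℝ, |θ| < ε → Tendsto (fun k => V k θ) atTop (𝓝 (g θ)))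
    (w : H) {θ : ℝ} (hθ : |θ| < ε) :
    (limUnder atTop fun k => ⟪w, V k (θ : ℂ)⟫_ℂ) = ⟪w, g θ⟫_ℂ :=
  (tendsto_const_nhds.inner (hconv θ hθ)).limUnder_eq

/-! ### Step 3: Riesz representation of the weak limit -/

/-- **Riesz.**  A conjugate-linear functional `φ` on a Hilbert space with `‖φ v‖ ≤ ‖v‖ C` (`C ≥ 0`) is
`v ↦ ⟪v, x⟫` for a vector `x` of norm `≤ C` (`InnerProductSpace.toDual` applied to the linear functional
`conj ∘ φ`). -/
theorem exists_inner_eq [CompleteSpace H] (φ : H → ℂ) {C : ℝ} (hC : 0 ≤ C)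
    (hadd : ∀ v w, φ (v + w) = φ v + φ w) (hsmul : ∀ (a : ℂ) (v : H), φ (a • v) = conj a * φ v)
    (hbd : ∀ v, ‖φ v‖ ≤ ‖v‖ * C) : ∃ x : H, ‖x‖ ≤ C ∧ ∀ v, ⟪v, x⟫_ℂ = φ v := by
  let ℓ : H →ₗ[ℂ] ℂ :=
    { toFun := fun v => conj (φ v)
      map_add' := fun v w => by simp only [hadd, map_add]
      map_smul' := fun a v => by
        simp only [hsmul, map_mul, Complex.conj_conj, smul_eq_mul, RingHom.id_apply] }
  have hℓ : ∀ v, ‖ℓ v‖ ≤ C * ‖v‖ := fun v => by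
    simp only [ℓ, LinearMap.coe_mk, AddHom.coe_mk, Complex.norm_conj]
    rw [mul_comm]
    exact hbd v
  refine ⟨(InnerProductSpace.toDual ℂ H).symm (ℓ.mkContinuous C hℓ), ?_, fun v => ?_⟩
  · rw [LinearIsometryEquiv.norm_map]
    exact ℓ.mkContinuous_norm_le hC hℓ
  · rw [← inner_conj_symm, InnerProductSpace.toDual_symm_apply]
    simp [ℓ]

/-- **The weak limit as a vector.**  There is `W : ℂ → H` with `⟪v, W ζ⟫ = lim_k ⟪v, V_k ζ⟫` for all `v` and
`‖W ζ‖ ≤ M e^{N |Im ζ|}`, at every point `ζ` of the strip. -/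
theorem exists_weakLimit [CompleteSpace H] (hε : 0 < ε)
    (hVd : ∀ k : ℕ, DifferentiableOn ℂ (V k) {θ : ℂ | |θ.re| < ε ∧ |θ.im| < (k : ℝ)})
    (hVb : ∀ (k : ℕ) (θ : ℂ), |θ.re| < ε → |θ.im| < (k : ℝ) → ‖V k θ‖ ≤ M * Real.exp (N * |θ.im|))
    (hconv : ∀ θ : ℝ, |θ| < ε → Tendsto (fun k => V k θ) atTop (𝓝 (g θ))) :
    ∃ W : ℂ → H, ∀ ζ : ℂ, |ζ.re| < ε →
      ‖W ζ‖ ≤ M * Real.exp (N * |ζ.im|) ∧ ∀ v : H, ⟪v, W ζ⟫_ℂ = limUnder atTop fun k => ⟪v, V k ζ⟫_ℂ := by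
  have hM : 0 ≤ M := nonneg_of_bound hε hVb
  have key : ∀ ζ : ℂ, ∃ x : H, |ζ.re| < ε →
      (‖x‖ ≤ M * Real.exp (N * |ζ.im|) ∧ ∀ v : H, ⟪v, x⟫_ℂ = limUnder atTop fun k => ⟪v, V k ζ⟫_ℂ) := by
    intro ζ
    by_cases hζ : |ζ.re| < ε
    · obtain ⟨x, hx, hxv⟩ := exists_inner_eq (fun v => limUnder atTop fun k => ⟪v, V k ζ⟫_ℂ)
        (mul_nonneg hM (Real.exp_pos _).le) (fun v w => lim_add hε hVd hVb hconv v w hζ)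
        (fun a v => lim_smul hε hVd hVb hconv a v hζ) (fun v => norm_lim_le hε hVd hVb hconv v hζ)
      exact ⟨x, fun _ => ⟨hx, hxv⟩⟩
    · exact ⟨0, fun h => absurd h hζ⟩
  choose W hW using key
  exact ⟨W, hW⟩

end HilbertVitali

open HilbertVitali in
/-- **Stub (T6) — VITALI FOR HILBERT-VALUED HOLOMORPHIC FAMILIES ON A STRIP (pure functional analysis).**
A sequence of `H`-valued functions `V_k`, holomorphic on the growing rectangles `{|Re θ| < ε, |Im θ| < k}` and
uniformly of exponential type there (`‖V_k θ‖ ≤ M e^{N|Im θ|}`), converging in norm at every real point `|θ| < ε`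
to `g θ`, has a holomorphic "limit" `W` on the strip `{|Re θ| < ε}` with the same bound and the same real values:
the weak limit `⟪w, W ζ⟫ = lim_k ⟪w, V_k ζ⟫` (scalar Vitali on each rectangle + Riesz), holomorphic by Dunford's
theorem (weakly holomorphic and locally bounded ⇒ holomorphic). -/
theorem stub_hilbertVitali :
    ∀ (H : Type) [NormedAddCommGroup H] [InnerProductSpace ℂ H] [CompleteSpace H] (ε M N : ℝ), 0 < ε →
        ∀ (V : ℕ → ℂ → H) (g : ℝ → H),
          (∀ k : ℕ, DifferentiableOn ℂ (V k) {θ : ℂ | |θ.re| < ε ∧ |θ.im| < (k : ℝ)}) →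
          (∀ (k : ℕ) (θ : ℂ), |θ.re| < ε → |θ.im| < (k : ℝ) → ‖V k θ‖ ≤ M * Real.exp (N * |θ.im|)) →
          (∀ θ : ℝ, |θ| < ε → Filter.Tendsto (fun k => V k θ) Filter.atTop (nhds (g θ))) →
          ∃ W : ℂ → H, DifferentiableOn ℂ W {θ : ℂ | |θ.re| < ε} ∧
            (∀ θ : ℂ, |θ.re| < ε → ‖W θ‖ ≤ M * Real.exp (N * |θ.im|)) ∧
            ∀ θ : ℝ, |θ| < ε → W θ = g θ := by
  intro H _ _ _ ε M N hε V g hVd hVb hconv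
  obtain ⟨W, hW⟩ := exists_weakLimit hε hVd hVb hconv
  have hM : 0 ≤ M := nonneg_of_bound hε hVb
  refine ⟨W, ?_, fun θ hθ => (hW θ hθ).1, fun θ hθ => ?_⟩
  · -- holomorphy: weakly holomorphic and locally bounded
    have hUo : IsOpen {θ : ℂ | |θ.re| < ε} :=
      isOpen_lt (continuous_abs.comp Complex.continuous_re) continuous_const
    refine Literature.Analysis.Complex.differentiableOn_of_forall_inner hUo ?_ fun v =>
      (differentiableOn_lim hε hVd hVb hconv v).congr fun z hz => (hW z hz).2 v
    intro z₀ hz₀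
    obtain ⟨r, hr, hball⟩ := Metric.isOpen_iff.1 hUo z₀ hz₀
    refine ⟨r, hr, M * Real.exp (|N| * (|z₀.im| + r)), fun z hz => ((hW z (hball hz)).1).trans ?_⟩
    refine bound_mono hM ?_
    have h1 : |(z - z₀).im| ≤ ‖z - z₀‖ := Complex.abs_im_le_norm (z - z₀)
    rw [Complex.sub_im] at h1
    have h2 : ‖z - z₀‖ < r := by rwa [← dist_eq_norm]
    have h3 := abs_sub_abs_le_abs_sub z.im z₀.im
    linarith
  · -- real points
    have hθ' : |(θ : ℂ).re| < ε := by simpa using hθ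
    refine ext_inner_left ℂ fun v => ?_
    rw [(hW θ hθ').2 v]
    exact lim_ofReal hconv v hθ

end Summit.QuantumFields.YangMills.Theorems.SoftKernelBoostCovariance.Sketch

end
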